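import Literature.Geometry.Riemannian.BishopGromovRelativeVolume
import Literature.Geometry.Riemannian.VolumeScaling
import Literature.Geometry.Riemannian.ChangGurskyYangProofs
import HarnessLib

/-!
# Relative volume comparison (0.5) under `Ric ≥ -(d-1)κ²`, every `κ > 0` (scaling)

Cheeger–Colding 1997, (0.5) (p. 408) / Zhu 1997, Thm. 3.1 at an arbitrary negative lower bound:
on a complete connected Riemannian `d`-manifold with `Ric ≥ -(d-1)κ² g`,
`Vol B_R(p) · V(κ r) ≤ Vol B_r(p) · V(κ R)` for `0 < r ≤ R`, `V(s) = ∫₀ˢ sinh^{d-1}`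
(equivalently with the model `V_{-κ²}(s) = κ^{-d} V(κ s)`: the constant cancels). From the case
`κ = 1` (`riemannianMeasure_ball_mul_le_of_ricci_ge_neg`) applied to `κ² g`: `Ric(κ²g) = Ric(g)`,
`d_{κ²g} = κ d_g` (balls correspond), `Vol_{κ²g} = κᵈ Vol_g` (`vol_constSmul`, the factor
cancels). No definitions, no named facts (D-0026). Groundwork for
`CheegerColding1997_sphereStability` (volume comparison at the scale `Ric ≥ -(n-1)τR⁻²`).

## References

* J. Cheeger, T. H. Colding, J. Differential Geom. 46 (1997) 406–480, (0.5) p. 408. [CheegerColding1997]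
* S.-H. Zhu, in *Comparison Geometry*, MSRI Publ. 30 (1997), Thm. 3.1. [Zhu1997ComparisonRicci]
-/

noncomputable section

open Bundle Set Function Filter MeasureTheory Manifold
open scoped Manifold ContDiff Topology ENNReal NNReal

namespace Literature.Geometry.Riemannian

open Lorentzian Lorentzian.PseudoRiemannianMetric

variable {d : ℕ} {M : Type*} [TopologicalSpace M] [ChartedSpace (EuclideanSpace ℝ (Fin d)) M]
  [IsManifold 𝓘(ℝ, EuclideanSpace ℝ (Fin d)) ∞ M] [T2Space M]
  (g : PseudoRiemannianMetric 𝓘(ℝ, EuclideanSpace ℝ (Fin d)) ∞ (EuclideanSpace ℝ (Fin d))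
    (TangentSpace 𝓘(ℝ, EuclideanSpace ℝ (Fin d)) : M → Type _)) [g.HasLeviCivita]
  [CovariantDerivative.ContMDiffCovariantDerivative g.leviCivita 1]
  [CovariantDerivative.ContMDiffCovariantDerivative g.leviCivita ∞]

/-- **Relative volume comparison (0.5) under `Ric ≥ -(d-1)κ²`** (Cheeger–Colding 1997, (0.5);
Zhu 1997, Thm. 3.1): `Vol B_R(p) · V(κ r) ≤ Vol B_r(p) · V(κ R)` for `0 < r ≤ R`, `κ > 0`,
`V(s) = ∫₀ˢ sinh^{d-1}`. [cite: CheegerColding1997, (0.5) (p. 408)]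
[cite: Zhu1997ComparisonRicci, Thm. 3.1] -/
theorem riemannianMeasure_ball_mul_le_of_ricci_ge_neg_sq (hd : 0 < d) [ConnectedSpace M]
    [T3Space M] [MeasurableSpace M] [BorelSpace M] (hg : g.IsRiemannian)
    (hc : IsGeodesicallyComplete g.leviCivita) {κ : ℝ} (hκ : 0 < κ)
    (hRic : ∀ (x : M) (w : TangentSpace 𝓘(ℝ, (EuclideanSpace ℝ (Fin d))) x),
      -((d : ℝ) - 1) * κ ^ 2 * g.val x w w ≤ g.leviCivita.ricci x w w)
    (p : M) {r R : ℝ} (hr : 0 < r) (hrR : r ≤ R) :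
    riemannianMeasure (I := 𝓘(ℝ, (EuclideanSpace ℝ (Fin d)))) (g.toContMDiffRiemannianMetric hg)
        {y : M | g.edist hg p y < ENNReal.ofReal R} *
        ENNReal.ofReal (∫ t in (0 : ℝ)..(κ * r), Real.sinh t ^ (d - 1)) ≤
      riemannianMeasure (I := 𝓘(ℝ, (EuclideanSpace ℝ (Fin d)))) (g.toContMDiffRiemannianMetric hg)
        {y : M | g.edist hg p y < ENNReal.ofReal r} *
        ENNReal.ofReal (∫ t in (0 : ℝ)..(κ * R), Real.sinh t ^ (d - 1)) := by
  have hκ2 : (0 : ℝ) < κ ^ 2 := by positivity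
  -- the rescaled metric `κ² g`
  set g' := g.constSmul (κ ^ 2) hκ2.ne' with hg'_def
  haveI : g'.HasLeviCivita := HasLeviCivita.constSmul (g := g) (κ ^ 2) hκ2.ne'
  have hLC : g'.leviCivita = g.leviCivita := leviCivita_constSmul (g := g) (κ ^ 2) hκ2.ne'
  haveI : CovariantDerivative.ContMDiffCovariantDerivative g'.leviCivita 1 := by
    rw [hLC]; infer_instance
  haveI : CovariantDerivative.ContMDiffCovariantDerivative g'.leviCivita ∞ := by
    rw [hLC]; infer_instance
  have hg' : g'.IsRiemannian := hg.constSmul hκ2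
  have hc' : IsGeodesicallyComplete g'.leviCivita := by rw [hLC]; exact hc
  have hRic' : ∀ (y : M) (w : TangentSpace 𝓘(ℝ, (EuclideanSpace ℝ (Fin d))) y),
      -((d : ℝ) - 1) * g'.val y w w ≤ g'.leviCivita.ricci y w w := fun y w ↦ by
    rw [hLC, hg'_def, constSmul_apply]
    have := hRic y w
    nlinarith
  -- balls correspond: `{d' < κ s} = {d < s}`
  have hd0 : ∀ y z : M, g'.edist hg' y z = ENNReal.ofReal κ * g.edist hg y z := fun y z ↦ by
    have h := edist_constSmul hg hκ2 y z
    rw [show (g.constSmul (κ ^ 2) hκ2.ne').edist (hg.constSmul hκ2) y z = g'.edist hg' y z from rfl]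
      at h
    rw [h, Real.sqrt_sq hκ.le]
  have hball : ∀ s : ℝ, {y : M | g'.edist hg' p y < ENNReal.ofReal (κ * s)} =
      {y : M | g.edist hg p y < ENNReal.ofReal s} := fun s ↦ by
    ext y
    simp only [mem_setOf_eq, hd0, ENNReal.ofReal_mul hκ.le]
    exact ENNReal.mul_lt_mul_iff_right (ENNReal.ofReal_pos.2 hκ).ne' ENNReal.ofReal_ne_top
  -- volumes scale by `κᵈ`
  have hvol : ∀ s : Set M,
      riemannianMeasure (I := 𝓘(ℝ, (EuclideanSpace ℝ (Fin d)))) (g'.toContMDiffRiemannianMetric hg') s =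
        ENNReal.ofReal κ ^ d *
          riemannianMeasure (I := 𝓘(ℝ, (EuclideanSpace ℝ (Fin d)))) (g.toContMDiffRiemannianMetric hg) s := by
    intro s
    have h1 := vol_constSmul g hκ2 s
    rw [show (g.constSmul (κ ^ 2) hκ2.ne').vol s = g'.vol s from rfl, PseudoRiemannianMetric.vol,
      PseudoRiemannianMetric.vol, riemVolume_eq hg', riemVolume_eq hg, Real.sqrt_sq hκ.le,
      finrank_euclideanSpace_fin] at h1
    exact h1
  -- (0.5) for `κ² g` at radii `κ r ≤ κ R`
  have key := riemannianMeasure_ball_mul_le_of_ricci_ge_neg g' hd hg' hc' hRic' p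
    (mul_pos hκ hr) (mul_le_mul_of_nonneg_left hrR hκ.le)
  rw [hball, hball, hvol, hvol, mul_assoc, mul_assoc] at key
  have hk0 : ENNReal.ofReal κ ^ d ≠ 0 := pow_ne_zero _ (ENNReal.ofReal_pos.2 hκ).ne'
  have hktop : ENNReal.ofReal κ ^ d ≠ ⊤ := ENNReal.pow_ne_top ENNReal.ofReal_ne_top
  exact (ENNReal.mul_le_mul_iff_right hk0 hktop).1 key

end Literature.Geometry.Riemannian

end
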